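import Summits.CriticalPhenomena.PercolationContinuityZ3.Theorems.Transplant.SkelNegBParamsFaceFloorsClrXA
import Summits.CriticalPhenomena.PercolationContinuityZ3.Theorems.Transplant.SkelNegBParamsFaceRunA
import Summits.CriticalPhenomena.PercolationContinuityZ3.Theorems.Transplant.SkelPhiFaceNumsYCore
import HarnessLib

/-!
# N1 params, M3 part 2a — **THE x-FACE's ALONG TARGET FLOORS `FL1`/`FL2`** (the last core lands in the arrival box along axis `0`) at the (ζ′) tuple:
# the along run ends within one stride of the target (`NrX_spec`) and the last core's along half-extent `u₀·(yBndC(N₃+1) + 2n)/(n·m)` is at most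
# `6u₀`, against the arrival box half-width `b₀ − 2 = 10·Kq·u₀ − 2`
(p3-g12, M3 pen, 2026-08-22; the fields `FloorsX2.FL1/FL2` of `Skelφ.numsX_provider₂` (SkelPhiFaceNumsXP2 :74–:77) at M3-FLOORS-SIGNATURE §1:
`pr := prFA`, `κ₀ := s₀ = u₀A`, `mod := modulus n_L h_L v_L v_β`, `P := fcellsA`, `b₀ := b0TA`, `qB₃ := qB3XA (RA′ mk)`, `R'₃ := RA′ mk`, `yL` any landing origin,
`Nr := NrX`, `N₃` any count with `(N₃+1)·RA′ ≤ n_L` and `11·(2(N₃+1) + (N₃+1+1000Kq)·RA′ + 8) ≤ 2ℓ_L` (both from `N3X_range` + the ×Kq floors, `floorsL_conds`)).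
* `yBndC_env` — the envelope `yBndC n_L h_L m qB₃ RA′ k + 2n_L ≤ 6·n_L·m`;
* **`FL1_XA_gen`**, **`FL2_XA_gen`** — the two fields for any `σT`, `N₃` (with `Nr := NrX yL σT x du z`); **`FL1_XA`**, **`FL2_XA`** — pinned at `σT := σTX yL x z`, `N₃ := N3X yL x z` over the M3 skeleton's standard premise block.
builds on p205010 (kernel theorem, internal audit signed; external expert review pending) — nothing in this file uses p205010; NOTHING is claimed about the node
`SamePDropOfSkeletonNeg₁` (OPEN); arithmetic only.
Lane `prim-bschramm-*`, seat `prim-bschramm-p3` (gen 12); helper file (`--supports stmt-CriticalPhenomena-4575 --as helper`).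
[cite: KozmaNitzan2024, §4 Lemma 12 (pp. 23–25)] [cite: MartineauTassion2017, §4.1]
-/

noncomputable section

open scoped Classical

namespace Summit.CriticalPhenomena.PercolationContinuityZ3.Theorems.Transplant

namespace PlanarSkeletonNeg

namespace NegB

open Literature.Probability.Percolation Literature.Probability.LatticeModels SimpleGraph
open Literature.Probability.Percolation.KozmaNitzan.Cells (oth sgOf sgOf_sign)
open SkelConc (Consts)
open Skelφ (shearUnit shearUnit_pos yBndC crossOffX)
open Skelφ.StepI (DataN)
open TwoAxis.Para (modulus coarse lam0 lam1)
open Neg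

namespace KS

section FloorsL

variable (κ : Consts) {V : Type} [DecidableEq V] [Countable V] {G : SimpleGraph V} [G.LocallyFinite] (Φ : PlanarSkeletonNeg G) (t : V)
  (p : unitInterval) (D : DataN V) (g f mk : ℕ)

/-- **The last core's correlation envelope**: `yBndC n_L h_L m (qB3XA RA′) RA′ k + 2n_L ≤ 6·n_L·m` for `k·RA′ ≤ n_L` and
`11·(2k + (k + 1000Kq)·RA′ + 8) ≤ 2ℓ_L`. [folklore] -/
theorem yBndC_env (hN : EqNumL κ Φ t p D g f) (hκ : (hL κ Φ t p D g f).natAbs ≤ 10 * nL κ Φ t p D g f) {k : ℕ}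
    (hk : (k : ℤ) * (RA' κ Φ t p D mk : ℤ) ≤ nL κ Φ t p D g f)
    (hℓ : 11 * (2 * (k : ℤ) + ((k : ℤ) + 1000 * Neg.Kq κ) * (RA' κ Φ t p D mk : ℤ) + 8) ≤ 2 * (ℓL κ Φ t p D g f : ℤ)) :
    yBndC (nL κ Φ t p D g f) (hL κ Φ t p D g f) (modulus (nL κ Φ t p D g f) (hL κ Φ t p D g f) (vL κ Φ t p D g f) (vβL κ Φ t p D g f))
        (qB3XA κ Φ t p D g f (RA' κ Φ t p D mk)) (RA' κ Φ t p D mk) k + 2 * (nL κ Φ t p D g f : ℤ) ≤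
      6 * (nL κ Φ t p D g f : ℤ) * modulus (nL κ Φ t p D g f) (hL κ Φ t p D g f) (vL κ Φ t p D g f) (vβL κ Φ t p D g f) := by
  obtain ⟨hn1, hℓ1⟩ := one_le_of_eqNumL κ Φ t p D g f hN
  obtain ⟨hm1, hm2⟩ := Skelφ.NegPrm.modulus_vβOf hn1 (hL κ Φ t p D g f) (ℓL κ Φ t p D g f) (vL κ Φ t p D g f)
  obtain ⟨hU1, hU2⟩ := clr_shearUnit_bounds κ Φ t p D g f hκ
  have hU0 : 0 < (shearUnit (nL κ Φ t p D g f) (hL κ Φ t p D g f) : ℤ) := shearUnit_pos hn1 _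
  unfold Skelφ.yBndC qB3XA Wrun
  push_cast
  set n : ℤ := (nL κ Φ t p D g f : ℤ) with hn
  set ℓ : ℤ := (ℓL κ Φ t p D g f : ℤ) with hℓdef
  set m := modulus (nL κ Φ t p D g f : ℤ) (hL κ Φ t p D g f) (vL κ Φ t p D g f) (vβL κ Φ t p D g f) with hm
  set U : ℤ := (shearUnit (nL κ Φ t p D g f) (hL κ Φ t p D g f) : ℤ) with hU
  set R : ℤ := (RA' κ Φ t p D mk : ℤ) with hR
  set Q : ℤ := (Neg.Kq κ : ℤ) with hQ
  have hmvβ : modulus (nL κ Φ t p D g f) (hL κ Φ t p D g f) (vL κ Φ t p D g f) (Skelφ.NegPrm.vβOf (nL κ Φ t p D g f) (hL κ Φ t p D g f) (ℓL κ Φ t p D g f) (vL κ Φ t p D g f)) = m := rfl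
  rw [hmvβ] at hm1 hm2
  have hn1' : (1 : ℤ) ≤ n := by rw [hn]; exact_mod_cast hn1
  have hℓ1' : (1 : ℤ) ≤ ℓ := by rw [hℓdef]; exact_mod_cast hℓ1
  have hk0 : (0 : ℤ) ≤ k := by positivity
  have hR0 : (0 : ℤ) ≤ R := by positivity
  have hQ1 : (1 : ℤ) ≤ Q := by rw [hQ]; exact_mod_cast Neg.one_le_Kq κ
  have hm0 : 0 < m := by nlinarith
  -- `U·W ≤ nℓ + U` for `W = nℓ/U + 1`
  set W' : ℤ := n * ℓ / U + 1 with hW'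
  have hW : U * W' ≤ n * ℓ + U := by
    have h1 : U * (n * ℓ / U) ≤ n * ℓ := Int.mul_ediv_self_le hU0.ne'
    rw [hW', mul_add, mul_one]; linarith
  -- the `k`-bookkeeping quantity `Y := 2k + kR + 1000QR + 3`
  have hY0 : (0 : ℤ) ≤ 2 * (k : ℤ) + k * R + 1000 * Q * R + 3 := by positivity
  -- (a) `m·(2n + kR) ≤ 3·n·m`
  have ha : m * (2 * n + (k : ℤ) * R) ≤ m * (3 * n) := mul_le_mul_of_nonneg_left (by linarith) hm0.le
  -- (b) the `U`-terms: `n·U·(Y + W') + 2n ≤ 3·n·m`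
  have h3 : n * (U * W') ≤ n * (n * ℓ + U) := mul_le_mul_of_nonneg_left hW (by linarith)
  have h4 : U * (2 * (k : ℤ) + k * R + 1000 * Q * R + 3) ≤ 11 * n * (2 * (k : ℤ) + k * R + 1000 * Q * R + 3) := mul_le_mul_of_nonneg_right hU2 hY0
  have h4' : n * (U * (2 * (k : ℤ) + k * R + 1000 * Q * R + 3)) ≤ n * (11 * n * (2 * (k : ℤ) + k * R + 1000 * Q * R + 3)) := mul_le_mul_of_nonneg_left h4 (by linarith)
  have h5 : 3 * n * (n * ℓ - n) ≤ 3 * n * m := mul_le_mul_of_nonneg_left hm1.le (by linarith)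
  have h6 : n * (n * (11 * (2 * (k : ℤ) + k * R + 1000 * Q * R + 3) + 16)) ≤ n * (n * (2 * ℓ)) :=
    mul_le_mul_of_nonneg_left (mul_le_mul_of_nonneg_left (by linarith) (by linarith)) (by linarith)
  have h7 : n * U ≤ n * (11 * n) := mul_le_mul_of_nonneg_left hU2 (by linarith)
  have h8 : n ≤ n * n := by nlinarith
  have e : m * (2 * n + (k : ℤ) * R) + n * U * (2 * (k : ℤ) + (W' + 1000 * Q * R + 2) + k * R + 1) + 2 * n =
      m * (2 * n + (k : ℤ) * R) + (n * (U * (2 * (k : ℤ) + k * R + 1000 * Q * R + 3)) + n * (U * W') + 2 * n) := by ring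
  rw [e]
  linarith

/-- The two side conditions of `yBndC_env` at `k := N₃ + 1` from the tangential range `N₃ + 1 ≤ 200·Kq + 10` and the `×Kq` floors
`2000·Kq·(RA′+2) ≤ n_L`, `22000·Kq·(RA′+2) ≤ ℓ_L`. [folklore] -/
theorem floorsL_conds {N₃ : ℕ} (hN₃ : N₃ + 1 ≤ 200 * Neg.Kq κ + 10)
    (hnA : 2000 * Neg.Kq κ * (RA' κ Φ t p D mk + 2) ≤ nL κ Φ t p D g f) (hℓA : 22000 * Neg.Kq κ * (RA' κ Φ t p D mk + 2) ≤ ℓL κ Φ t p D g f) :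
    (((N₃ + 1 : ℕ) : ℤ)) * (RA' κ Φ t p D mk : ℤ) ≤ nL κ Φ t p D g f ∧
      11 * (2 * ((N₃ + 1 : ℕ) : ℤ) + (((N₃ + 1 : ℕ) : ℤ) + 1000 * Neg.Kq κ) * (RA' κ Φ t p D mk : ℤ) + 8) ≤ 2 * (ℓL κ Φ t p D g f : ℤ) := by
  have hq : (1 : ℤ) ≤ Neg.Kq κ := by exact_mod_cast Neg.one_le_Kq κ
  have hk : ((N₃ + 1 : ℕ) : ℤ) ≤ 200 * (Neg.Kq κ : ℤ) + 10 := by exact_mod_cast hN₃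
  have hn : 2000 * (Neg.Kq κ : ℤ) * ((RA' κ Φ t p D mk : ℤ) + 2) ≤ nL κ Φ t p D g f := by exact_mod_cast hnA
  have hl : 22000 * (Neg.Kq κ : ℤ) * ((RA' κ Φ t p D mk : ℤ) + 2) ≤ ℓL κ Φ t p D g f := by exact_mod_cast hℓA
  have hR0 : (0 : ℤ) ≤ (RA' κ Φ t p D mk : ℤ) := by positivity
  have hk0 : (0 : ℤ) ≤ ((N₃ + 1 : ℕ) : ℤ) := by positivity
  constructor
  · nlinarith
  · nlinarith

/-- **`FL2` at the (ζ′) x-face tuple**: the last core's upper along reading is inside the arrival box. [cite: KozmaNitzan2024, §4 Lemma 12 (pp. 23–25)] -/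
theorem FL2_XA_gen (hN : EqNumL κ Φ t p D g f) (hκ : (hL κ Φ t p D g f).natAbs ≤ 10 * nL κ Φ t p D g f) (x : Site 2) (du : MDir) (z : Site 2)
    (yL : Site 2) (σT : ℤ) (hX : u₀A κ Φ t p D g f ≤ sgOf du * (T0X κ Φ t p D g f x du z - FcA κ Φ t p D g f (yTX0 κ Φ t p D g f yL σT)))
    {N₃ : ℕ} (hk : (((N₃ + 1 : ℕ) : ℤ)) * (RA' κ Φ t p D mk : ℤ) ≤ nL κ Φ t p D g f)
    (hℓ : 11 * (2 * ((N₃ + 1 : ℕ) : ℤ) + (((N₃ + 1 : ℕ) : ℤ) + 1000 * Neg.Kq κ) * (RA' κ Φ t p D mk : ℤ) + 8) ≤ 2 * (ℓL κ Φ t p D g f : ℤ)) :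
    (nL κ Φ t p D g f : ℤ) * modulus (nL κ Φ t p D g f) (hL κ Φ t p D g f) (vL κ Φ t p D g f) (vβL κ Φ t p D g f) *
        (FcA κ Φ t p D g f (yL + Skelφ.crossOffX (nL κ Φ t p D g f) (hL κ Φ t p D g f) (vL κ Φ t p D g f) (sgOf du) σT (NrX κ Φ t p D g f yL σT x du z)) + 1) +
      u₀A κ Φ t p D g f * (yBndC (nL κ Φ t p D g f) (hL κ Φ t p D g f) (modulus (nL κ Φ t p D g f) (hL κ Φ t p D g f) (vL κ Φ t p D g f) (vβL κ Φ t p D g f))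
        (qB3XA κ Φ t p D g f (RA' κ Φ t p D mk)) (RA' κ Φ t p D mk) (N₃ + 1) + nL κ Φ t p D g f) ≤
      (nL κ Φ t p D g f : ℤ) * modulus (nL κ Φ t p D g f) (hL κ Φ t p D g f) (vL κ Φ t p D g f) (vβL κ Φ t p D g f) *
        ((fcellsA κ Φ t p D g f).cen (x + stepVec du) 0 + (b0TA κ Φ t p D g f 0 : ℤ) - 2 - z 0) := by
  obtain ⟨hn1, hℓ1⟩ := one_le_of_eqNumL κ Φ t p D g f hN
  have hm0 : 0 < modulus (nL κ Φ t p D g f) (hL κ Φ t p D g f) (vL κ Φ t p D g f) (vβL κ Φ t p D g f) := Skelφ.NegPrm.modulus_vβOf_pos hn1 hℓ1 _ _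
  have henv := yBndC_env κ Φ t p D g f mk hN hκ hk hℓ
  obtain ⟨hf, -⟩ := NrX_spec κ Φ t p D g f hN yL σT x du z hX
  obtain ⟨hf1, hf2⟩ := abs_le.1 hf
  have hu : 1 ≤ u₀A κ Φ t p D g f := (units_eqA κ Φ t p D g f).2.2.2.2.2.2.1
  have hb : (b0TA κ Φ t p D g f 0 : ℤ) = 10 * (Neg.Kq κ : ℤ) * u₀A κ Φ t p D g f := (units_eqA κ Φ t p D g f).2.2.2.2.1
  have hq : (1 : ℤ) ≤ Neg.Kq κ := by exact_mod_cast Neg.one_le_Kq κ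
  have hn1' : (1 : ℤ) ≤ (nL κ Φ t p D g f : ℤ) := by exact_mod_cast hn1
  set n : ℤ := (nL κ Φ t p D g f : ℤ)
  set m := modulus (nL κ Φ t p D g f) (hL κ Φ t p D g f) (vL κ Φ t p D g f) (vβL κ Φ t p D g f)
  set u := u₀A κ Φ t p D g f
  set Q : ℤ := (Neg.Kq κ : ℤ)
  set F := FcA κ Φ t p D g f (yL + Skelφ.crossOffX (nL κ Φ t p D g f) (hL κ Φ t p D g f) (vL κ Φ t p D g f) (sgOf du) σT (NrX κ Φ t p D g f yL σT x du z))
  set Bc := yBndC (nL κ Φ t p D g f) (hL κ Φ t p D g f) m (qB3XA κ Φ t p D g f (RA' κ Φ t p D mk)) (RA' κ Φ t p D mk) (N₃ + 1)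
  have hT : (fcellsA κ Φ t p D g f).cen (x + stepVec du) 0 + (b0TA κ Φ t p D g f 0 : ℤ) - 2 - z 0 = T0X κ Φ t p D g f x du z + 10 * Q * u - 2 := by
    rw [hb]; simp only [T0X]; ring
  rw [hT]
  have hnm : 0 < n * m := mul_pos (by linarith) hm0
  have hBn : u * (Bc + n) ≤ u * (6 * n * m) := mul_le_mul_of_nonneg_left (by linarith) (by linarith)
  have hQu : u ≤ Q * u := by nlinarith
  have key : n * m * (F + 1) + u * (6 * n * m) ≤ n * m * (T0X κ Φ t p D g f x du z + 10 * Q * u - 2) := by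
    have : n * m * (F + 1 + 6 * u) ≤ n * m * (T0X κ Φ t p D g f x du z + 10 * Q * u - 2) := mul_le_mul_of_nonneg_left (by linarith) hnm.le
    linarith
  linarith

/-- **`FL1` at the (ζ′) x-face tuple**: the last core's lower along reading is inside the arrival box. [cite: KozmaNitzan2024, §4 Lemma 12 (pp. 23–25)] -/
theorem FL1_XA_gen (hN : EqNumL κ Φ t p D g f) (hκ : (hL κ Φ t p D g f).natAbs ≤ 10 * nL κ Φ t p D g f) (x : Site 2) (du : MDir) (z : Site 2)
    (yL : Site 2) (σT : ℤ) (hX : u₀A κ Φ t p D g f ≤ sgOf du * (T0X κ Φ t p D g f x du z - FcA κ Φ t p D g f (yTX0 κ Φ t p D g f yL σT)))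
    {N₃ : ℕ} (hk : (((N₃ + 1 : ℕ) : ℤ)) * (RA' κ Φ t p D mk : ℤ) ≤ nL κ Φ t p D g f)
    (hℓ : 11 * (2 * ((N₃ + 1 : ℕ) : ℤ) + (((N₃ + 1 : ℕ) : ℤ) + 1000 * Neg.Kq κ) * (RA' κ Φ t p D mk : ℤ) + 8) ≤ 2 * (ℓL κ Φ t p D g f : ℤ)) :
    (nL κ Φ t p D g f : ℤ) * modulus (nL κ Φ t p D g f) (hL κ Φ t p D g f) (vL κ Φ t p D g f) (vβL κ Φ t p D g f) *
        ((fcellsA κ Φ t p D g f).cen (x + stepVec du) 0 - (b0TA κ Φ t p D g f 0 : ℤ) + 2 - z 0 -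
          FcA κ Φ t p D g f (yL + Skelφ.crossOffX (nL κ Φ t p D g f) (hL κ Φ t p D g f) (vL κ Φ t p D g f) (sgOf du) σT (NrX κ Φ t p D g f yL σT x du z))) ≤
      -(u₀A κ Φ t p D g f * (yBndC (nL κ Φ t p D g f) (hL κ Φ t p D g f) (modulus (nL κ Φ t p D g f) (hL κ Φ t p D g f) (vL κ Φ t p D g f) (vβL κ Φ t p D g f))
        (qB3XA κ Φ t p D g f (RA' κ Φ t p D mk)) (RA' κ Φ t p D mk) (N₃ + 1) + 2 * (nL κ Φ t p D g f : ℤ))) -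
        (nL κ Φ t p D g f : ℤ) * modulus (nL κ Φ t p D g f) (hL κ Φ t p D g f) (vL κ Φ t p D g f) (vβL κ Φ t p D g f) := by
  obtain ⟨hn1, hℓ1⟩ := one_le_of_eqNumL κ Φ t p D g f hN
  have hm0 : 0 < modulus (nL κ Φ t p D g f) (hL κ Φ t p D g f) (vL κ Φ t p D g f) (vβL κ Φ t p D g f) := Skelφ.NegPrm.modulus_vβOf_pos hn1 hℓ1 _ _
  have henv := yBndC_env κ Φ t p D g f mk hN hκ hk hℓ
  obtain ⟨hf, -⟩ := NrX_spec κ Φ t p D g f hN yL σT x du z hX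
  obtain ⟨hf1, hf2⟩ := abs_le.1 hf
  have hu : 1 ≤ u₀A κ Φ t p D g f := (units_eqA κ Φ t p D g f).2.2.2.2.2.2.1
  have hb : (b0TA κ Φ t p D g f 0 : ℤ) = 10 * (Neg.Kq κ : ℤ) * u₀A κ Φ t p D g f := (units_eqA κ Φ t p D g f).2.2.2.2.1
  have hq : (1 : ℤ) ≤ Neg.Kq κ := by exact_mod_cast Neg.one_le_Kq κ
  have hn1' : (1 : ℤ) ≤ (nL κ Φ t p D g f : ℤ) := by exact_mod_cast hn1
  set n : ℤ := (nL κ Φ t p D g f : ℤ)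
  set m := modulus (nL κ Φ t p D g f) (hL κ Φ t p D g f) (vL κ Φ t p D g f) (vβL κ Φ t p D g f)
  set u := u₀A κ Φ t p D g f
  set Q : ℤ := (Neg.Kq κ : ℤ)
  set F := FcA κ Φ t p D g f (yL + Skelφ.crossOffX (nL κ Φ t p D g f) (hL κ Φ t p D g f) (vL κ Φ t p D g f) (sgOf du) σT (NrX κ Φ t p D g f yL σT x du z))
  set Bc := yBndC (nL κ Φ t p D g f) (hL κ Φ t p D g f) m (qB3XA κ Φ t p D g f (RA' κ Φ t p D mk)) (RA' κ Φ t p D mk) (N₃ + 1)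
  have e : (fcellsA κ Φ t p D g f).cen (x + stepVec du) 0 - (b0TA κ Φ t p D g f 0 : ℤ) + 2 - z 0 - F = T0X κ Φ t p D g f x du z - 10 * Q * u + 2 - F := by
    rw [hb]; simp only [T0X]; ring
  rw [e]
  have hnm : 0 < n * m := mul_pos (by linarith) hm0
  have hBn : u * (Bc + 2 * n) ≤ u * (6 * n * m) := mul_le_mul_of_nonneg_left henv (by linarith)
  have hQu : u ≤ Q * u := by nlinarith
  have key : n * m * (T0X κ Φ t p D g f x du z - 10 * Q * u + 2 - F) + u * (6 * n * m) + n * m ≤ 0 := by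
    have : n * m * (T0X κ Φ t p D g f x du z - 10 * Q * u + 2 - F + 6 * u + 1) ≤ n * m * 0 := mul_le_mul_of_nonneg_left (by linarith) hnm.le
    linarith
  linarith

/-- **`FL2` pinned** at the M3 skeleton's choice functions (`σT := σTX`, `N₃ := N3X`, `Nr := NrX`) over its standard premise block (the unused
`r qB B` binders dropped). [cite: KozmaNitzan2024, §4 Lemma 12 (pp. 23–25)] -/
theorem FL2_XA (hN : EqNumL κ Φ t p D g f) (hκ : (hL κ Φ t p D g f).natAbs ≤ 10 * nL κ Φ t p D g f)
    (hnA : 2000 * Neg.Kq κ * (RA' κ Φ t p D mk + 2) ≤ nL κ Φ t p D g f) (hℓA : 22000 * Neg.Kq κ * (RA' κ Φ t p D mk + 2) ≤ ℓL κ Φ t p D g f)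
    (x : Site 2) (du : MDir) (hd : du.1 = 0) (j : ℕ) (hj : j < (fcellsA κ Φ t p D g f).K) (z : Site 2) {E : ℕ} {kE : ℤ}
    (hlev1 : (fcellsA κ Φ t p D g f).faceL 0 j - E ≤ (fcellsA κ Φ t p D g f).lev du x z) (hlev2 : (fcellsA κ Φ t p D g f).lev du x z ≤ (fcellsA κ Φ t p D g f).faceL 0 j + E)
    (hz : |z 1 - (fcellsA κ Φ t p D g f).cen x 1| ≤ kE) (hEu : (E : ℤ) ≤ u₀A κ Φ t p D g f) (hkE : kE ≤ 5 * ((fcellsA κ Φ t p D g f).r 1 : ℤ))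
    (yL : Site 2) (he0 : |FcA κ Φ t p D g f (yTX0 κ Φ t p D g f yL (σTX κ Φ t p D g f yL x z))| ≤ 6 * u₀A κ Φ t p D g f)
    (he1 : |F1cA κ Φ t p D g f yL| ≤ 6 * u₁A κ Φ t p D g f) :
    (((nL κ Φ t p D g f) : ℕ) : ℤ) * (modulus (nL κ Φ t p D g f) (hL κ Φ t p D g f) (vL κ Φ t p D g f) (vβL κ Φ t p D g f)) * (coarse (prFA κ Φ t p D g f).c₀ ((prFA κ Φ t p D g f).D / 2) (prFA κ Φ t p D g f).D (lam0 (prFA κ Φ t p D g f).A (prFA κ Φ t p D g f).vα (prFA κ Φ t p D g f).vβ (yL + crossOffX (nL κ Φ t p D g f) (prFA κ Φ t p D g f).h (prFA κ Φ t p D g f).vα (sgOf du) (σTX κ Φ t p D g f yL x z) (NrX κ Φ t p D g f yL (σTX κ Φ t p D g f yL x z) x du z))) + 1) + (((fcellsA κ Φ t p D g f).s 0 : ℕ) : ℤ) * (yBndC (nL κ Φ t p D g f) (prFA κ Φ t p D g f).h (modulus (nL κ Φ t p D g f) (hL κ Φ t p D g f) (vL κ Φ t p D g f) (vβL κ Φ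 t p D g f)) (qB3XA κ Φ t p D g f (RA' κ Φ t p D mk)) (RA' κ Φ t p D mk) ((N3X κ Φ t p D g f yL x z) + 1) + (nL κ Φ t p D g f)) ≤ (nL κ Φ t p D g f) * (modulus (nL κ Φ t p D g f) (hL κ Φ t p D g f) (vL κ Φ t p D g f) (vβL κ Φ t p D g f)) * ((fcellsA κ Φ t p D g f).cen (x + stepVec du) 0 + (b0TA κ Φ t p D g f) 0 - 2 - z 0)   := by
  obtain ⟨hX, -⟩ := NrX_range κ Φ t p D g f hN x du hd z hj hlev1 hlev2 yL (σTX κ Φ t p D g f yL x z) he0 (by linarith [(units_eqA κ Φ t p D g f).2.2.2.2.2.2.1])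
  have hN3 := N3X_range κ Φ t p D g f yL x z hz hkE he1 (by linarith [(units_eqA κ Φ t p D g f).2.2.2.2.2.2.2])
  obtain ⟨hk, hℓ⟩ := floorsL_conds κ Φ t p D g f mk hN3 hnA hℓA
  exact FL2_XA_gen κ Φ t p D g f mk hN hκ x du z yL (σTX κ Φ t p D g f yL x z) hX hk hℓ

/-- **`FL1` pinned** at the M3 skeleton's choice functions. [cite: KozmaNitzan2024, §4 Lemma 12 (pp. 23–25)] -/
theorem FL1_XA (hN : EqNumL κ Φ t p D g f) (hκ : (hL κ Φ t p D g f).natAbs ≤ 10 * nL κ Φ t p D g f)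
    (hnA : 2000 * Neg.Kq κ * (RA' κ Φ t p D mk + 2) ≤ nL κ Φ t p D g f) (hℓA : 22000 * Neg.Kq κ * (RA' κ Φ t p D mk + 2) ≤ ℓL κ Φ t p D g f)
    (x : Site 2) (du : MDir) (hd : du.1 = 0) (j : ℕ) (hj : j < (fcellsA κ Φ t p D g f).K) (z : Site 2) {E : ℕ} {kE : ℤ}
    (hlev1 : (fcellsA κ Φ t p D g f).faceL 0 j - E ≤ (fcellsA κ Φ t p D g f).lev du x z) (hlev2 : (fcellsA κ Φ t p D g f).lev du x z ≤ (fcellsA κ Φ t p D g f).faceL 0 j + E)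
    (hz : |z 1 - (fcellsA κ Φ t p D g f).cen x 1| ≤ kE) (hEu : (E : ℤ) ≤ u₀A κ Φ t p D g f) (hkE : kE ≤ 5 * ((fcellsA κ Φ t p D g f).r 1 : ℤ))
    (yL : Site 2) (he0 : |FcA κ Φ t p D g f (yTX0 κ Φ t p D g f yL (σTX κ Φ t p D g f yL x z))| ≤ 6 * u₀A κ Φ t p D g f)
    (he1 : |F1cA κ Φ t p D g f yL| ≤ 6 * u₁A κ Φ t p D g f) :
    (((nL κ Φ t p D g f) : ℕ) : ℤ) * (modulus (nL κ Φ t p D g f) (hL κ Φ t p D g f) (vL κ Φ t p D g f) (vβL κ Φ t p D g f)) * ((fcellsA κ Φ t p D g f).cen (x + stepVec du) 0 - (b0TA κ Φ t p D g f) 0 + 2 - z 0 - coarse (prFA κ Φ t p D g f).c₀ ((prFA κ Φ t p D g f).D / 2) (prFA κ Φ t p D g f).D (lam0 (prFA κ Φ t p D g f).A (prFA κ Φ t p D g f).vα (prFA κ Φ t p D g f).vβ (yL + crossOffX (nL κ Φ t p D g f) (prFA κ Φ t p D g f).h (prFA κ Φ t p D g f).vα (sgOf du) (σTX κ Φ t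 p D g f yL x z) (NrX κ Φ t p D g f yL (σTX κ Φ t p D g f yL x z) x du z)))) ≤ -((((fcellsA κ Φ t p D g f).s 0 : ℕ) : ℤ) * (yBndC (nL κ Φ t p D g f) (prFA κ Φ t p D g f).h (modulus (nL κ Φ t p D g f) (hL κ Φ t p D g f) (vL κ Φ t p D g f) (vβL κ Φ t p D g f)) (qB3XA κ Φ t p D g f (RA' κ Φ t p D mk)) (RA' κ Φ t p D mk) ((N3X κ Φ t p D g f yL x z) + 1) + 2 * (nL κ Φ t p D g f))) - (nL κ Φ t p D g f) * (modulus (nL κ Φ t p D g f) (hL κ Φ t p D g f) (vL κ Φ t p D g f) (vβL κ Φ t p D g f))   := by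
  obtain ⟨hX, -⟩ := NrX_range κ Φ t p D g f hN x du hd z hj hlev1 hlev2 yL (σTX κ Φ t p D g f yL x z) he0 (by linarith [(units_eqA κ Φ t p D g f).2.2.2.2.2.2.1])
  have hN3 := N3X_range κ Φ t p D g f yL x z hz hkE he1 (by linarith [(units_eqA κ Φ t p D g f).2.2.2.2.2.2.2])
  obtain ⟨hk, hℓ⟩ := floorsL_conds κ Φ t p D g f mk hN3 hnA hℓA
  exact FL1_XA_gen κ Φ t p D g f mk hN hκ x du z yL (σTX κ Φ t p D g f yL x z) hX hk hℓ

end FloorsL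

end KS

end NegB

end PlanarSkeletonNeg

end Summit.CriticalPhenomena.PercolationContinuityZ3.Theorems.Transplant

end
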